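import Summits.QuantumFields.YangMills.Theorems.DiagonalMirrorRPRTwistLettersDefs

/-!
# Crux `WeakCouplingHypercubicLimitRP` (stmt-QuantumFields-27398) / aside `DiagonalMirrorRPR` (stmt-QuantumFields-10604), door B, letter R1:
# the TWO-SHIFT WINDOW EXTRACTION (card #119 `two-shift-window-extraction`, PASS-WITH-PRICE) — re-homed, sorry-free, binder form

Helper file (`--supports stmt-QuantumFields-27398 --as helper`) of the hand `hand-10604-wilsonDiagModel-3` g0, docket director-ym g24 O4 WORD 42 (1)(a)
(idea-crit-9 g13 verdict #119, table adopted O4 WORD 42): LAND §1–§2 of the crux-ideate seat «spectral-transfer» g2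
(`pub/ym-o4cluster/cruxidea-10604-r2/spectral-transfer/Sketch-spectral-transfer-g2.lean`, sha16 `4e9ac7c070738e84`) VERBATIM, in BINDER form
(every statement is about a model binder `𝔪 : DiagonalSliceModel r sch` and probe data `𝔭 : TwoShiftProbes 𝔪`; nothing is pinned to a term), as ONE
Theorems file in the door-B namespace `…Cruxes.DiagonalMirrorRPR.SignTwistedDiagonalTrace` (NOT the ideator's `…SpectralTransferG2`).  Bodies and
docstrings of the declarations are the seat's, byte-for-byte.  It closes nothing by itself.

* §1 (finite-dimensional currency, PROVED): `sandwich`, `sandwich_sub_sandwich`, `abs_signed_pow_le`, `twoShift_signal_le`, `slowest_signal_le`,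
  `extraction_step`, `signal_shape` — the second shift `S(n) − S(2n)` kills the mean and the vacuum row exactly, off-top rows are
  `≤ 2 W r^{N−4n−2d}` in the SAME slowest modulus `r`, so a slowest-first extraction closes;
* §2 (model level, PROVED on binders): `TwoShiftProbes 𝔪` (probe data), the LETTERS `CoarseGap`, `JunkVisible`, `SlowestVisible`, `BudgetDecay`
  (predicates on `𝔭`, hypotheses of the bridge — NOT facts), ★ `slowest_le_exp` (`r_k ≤ e^{−(Δ/8) a_k}` eventually), `oddTwistGap_of_twoShiftLetters`
  (⇒ R1 `OddTwistGap 𝔪`), `evenGap_of_twoShiftLetters`.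
  PRICE of record (g13 p-W1): `vis, W, scale, budget` are free reals tied to the model only through `signal`; a supplier must DEFINE them from an
  actual box-local probe and the shifted sandwich (`budget` model-external, `BudgetDecay` then a THEOREM from `DiagCluster`) — not done here.

HONEST FRAMING: re-homing of proved bookkeeping and bridges; NO letter is proved for Wilson's model (no `TwoShiftProbes` instance is supplied);
R1, D1′, S6i, ⟨27398⟩ (0∕2) and the aside ⟨10604⟩ are OPEN; nothing here bears on the summit; the Yang–Mills mass gap is NOT proved here or
anywhere in the tree.  One real-valued definition (`sandwich`), one structure (`TwoShiftProbes`), four `Prop`-valued predicates on probe data;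
no instance, no notation, `autoImplicit false`.

References: Osterwalder–Seiler, Ann. Phys. 110 (1978) §2–3; Seiler, LNP 159 (1982) Ch. 2 (transfer-matrix currency of the card).
-/

set_option autoImplicit false

noncomputable section

open scoped SchwartzMap
open MeasureTheory Filter Topology
open Literature.MathematicalPhysics.QuantumLattice Literature.MathematicalPhysics.AQFT
  Literature.MathematicalPhysics.QuantumFieldTheory

namespace Summit.QuantumFields.YangMills.Cruxes.DiagonalMirrorRPR.SignTwistedDiagonalTrace

/-! ## §1 Finite-dimensional currency: the two-shift sandwich (PROVED) -/

section FiniteDim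

variable {ι : Type} [Fintype ι] [DecidableEq ι]

/-- The shifted sandwich `S(m) = Σ_a Σ_b ω a b · x_b^{2m} · (σ_a x_a)^{N − 2m − 2d}` (`= ⟨Θ_swap Y · τ_{m d} Y⟩ · Tr K₁^N` for a probe
of depth `d`; `x` the moduli in `[0,1]`, `σ` the `U`-signs, `ω ≥ 0` the two-index weights). -/
def sandwich (ω : ι → ι → ℝ) (x σ : ι → ℝ) (N d m : ℕ) : ℝ :=
  ∑ a, ∑ b, ω a b * (x b ^ (2 * m) * (σ a * x a) ^ (N - 2 * m - 2 * d))

omit [DecidableEq ι] in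
/-- The second difference of the shifted sandwich, termwise. -/
theorem sandwich_sub_sandwich (ω : ι → ι → ℝ) (x σ : ι → ℝ) (N d n : ℕ) :
    sandwich ω x σ N d n - sandwich ω x σ N d (2 * n) =
      ∑ a, ∑ b, ω a b * (x b ^ (2 * n) * (σ a * x a) ^ (N - 2 * n - 2 * d) -
        x b ^ (2 * (2 * n)) * (σ a * x a) ^ (N - 2 * (2 * n) - 2 * d)) := by
  simp only [sandwich, ← Finset.sum_sub_distrib, ← mul_sub]

/-- a signed power of a modulus is bounded by the unsigned one -/
theorem abs_signed_pow_le {s y : ℝ} (hs : s = 1 ∨ s = -1) (hy : 0 ≤ y) (L : ℕ) : |(s * y) ^ L| ≤ y ^ L := by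
  rcases hs with h | h
  · simp [h, abs_pow, abs_of_nonneg hy]
  · simp [h, abs_pow, abs_neg, abs_of_nonneg hy]

/-- **Two-shift signal bound.**  The second shift kills the vacuum entry exactly; the top row is the positive signal; every other row is
bounded by twice its row sum times `x_a^{N−4n−2d}`. -/
theorem twoShift_signal_le (ω : ι → ι → ℝ) (x σ : ι → ℝ) (o : ι) (N d n : ℕ)
    (hω : ∀ a b, 0 ≤ ω a b) (hx0 : ∀ a, 0 ≤ x a) (hx1 : ∀ a, x a ≤ 1)
    (hσ : ∀ a, σ a = 1 ∨ σ a = -1) (hxo : x o = 1) (hσo : σ o = 1) (hN : 4 * n + 2 * d ≤ N) :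
    ∑ b, ω o b * (x b ^ (2 * n) - x b ^ (4 * n)) ≤
      (sandwich ω x σ N d n - sandwich ω x σ N d (2 * n)) +
        2 * ∑ a ∈ Finset.univ.erase o, ∑ b, ω a b * x a ^ (N - 4 * n - 2 * d) := by
  rw [sandwich_sub_sandwich]
  have hsplit := Finset.add_sum_erase Finset.univ
    (fun a => ∑ b, ω a b * (x b ^ (2 * n) * (σ a * x a) ^ (N - 2 * n - 2 * d) -
        x b ^ (2 * (2 * n)) * (σ a * x a) ^ (N - 2 * (2 * n) - 2 * d))) (Finset.mem_univ o)
  rw [← hsplit]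
  have hL2 : N - 2 * (2 * n) - 2 * d = N - 4 * n - 2 * d := by omega
  have hL : N - 4 * n - 2 * d ≤ N - 2 * n - 2 * d := by omega
  -- the top row is exactly the signal
  have hrow : ∑ b, ω o b * (x b ^ (2 * n) * (σ o * x o) ^ (N - 2 * n - 2 * d) -
      x b ^ (2 * (2 * n)) * (σ o * x o) ^ (N - 2 * (2 * n) - 2 * d)) =
      ∑ b, ω o b * (x b ^ (2 * n) - x b ^ (4 * n)) := by
    refine Finset.sum_congr rfl fun b _ => ?_
    simp only [hxo, hσo, mul_one, one_pow]
    ring_nf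
  -- every other row: termwise `ω·D ≥ −2 ω x_a^{L₂}`
  have key : ∀ a b, 0 ≤ ω a b * (x b ^ (2 * n) * (σ a * x a) ^ (N - 2 * n - 2 * d) -
      x b ^ (2 * (2 * n)) * (σ a * x a) ^ (N - 2 * (2 * n) - 2 * d)) +
      2 * (ω a b * x a ^ (N - 4 * n - 2 * d)) := by
    intro a b
    rw [hL2]
    set u := (σ a * x a) ^ (N - 2 * n - 2 * d) with hu
    set v := (σ a * x a) ^ (N - 4 * n - 2 * d) with hv
    set A := x a ^ (N - 2 * n - 2 * d) with hA
    set B := x a ^ (N - 4 * n - 2 * d) with hB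
    set p := x b ^ (2 * n) with hp
    set q := x b ^ (2 * (2 * n)) with hq
    have huA : |u| ≤ A := abs_signed_pow_le (hσ a) (hx0 a) _
    have hvB : |v| ≤ B := abs_signed_pow_le (hσ a) (hx0 a) _
    have hAB : A ≤ B := pow_le_pow_of_le_one (hx0 a) (hx1 a) hL
    have hA0 : 0 ≤ A := pow_nonneg (hx0 a) _
    have hp0 : 0 ≤ p := pow_nonneg (hx0 b) _
    have hp1 : p ≤ 1 := pow_le_one₀ (hx0 b) (hx1 b)
    have hq0 : 0 ≤ q := pow_nonneg (hx0 b) _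
    have hq1 : q ≤ 1 := pow_le_one₀ (hx0 b) (hx1 b)
    have hu' : -A ≤ u := (abs_le.1 huA).1
    have hv' : v ≤ B := (abs_le.1 hvB).2
    have h1 : -A ≤ p * u := by nlinarith [mul_nonneg hp0 (by linarith : 0 ≤ u + A)]
    have h2 : q * v ≤ B := by nlinarith [mul_nonneg hq0 (by linarith : 0 ≤ B - v)]
    have h3 : -(2 * B) ≤ p * u - q * v := by linarith
    have := mul_le_mul_of_nonneg_left h3 (hω a b)
    linarith
  have h2 : 0 ≤ ∑ a ∈ Finset.univ.erase o, ∑ b, ω a b * (x b ^ (2 * n) * (σ a * x a) ^ (N - 2 * n - 2 * d) -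
      x b ^ (2 * (2 * n)) * (σ a * x a) ^ (N - 2 * (2 * n) - 2 * d)) +
      2 * ∑ a ∈ Finset.univ.erase o, ∑ b, ω a b * x a ^ (N - 4 * n - 2 * d) := by
    rw [Finset.mul_sum, ← Finset.sum_add_distrib]
    refine Finset.sum_nonneg fun a _ => ?_
    rw [Finset.mul_sum, ← Finset.sum_add_distrib]
    exact Finset.sum_nonneg fun b _ => key a b
  rw [hrow]
  linarith

/-- **Slowest-first form.**  For a single non-top mode `b`, with `r` dominating every non-top modulus and `W` the total off-top weight:
`ω(o,b) (x_b^{2n} − x_b^{4n}) ≤ (S(n) − S(2n)) + 2 W r^{N−4n−2d}`. -/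
theorem slowest_signal_le (ω : ι → ι → ℝ) (x σ : ι → ℝ) (o : ι) (N d n : ℕ)
    (hω : ∀ a b, 0 ≤ ω a b) (hx0 : ∀ a, 0 ≤ x a) (hx1 : ∀ a, x a ≤ 1)
    (hσ : ∀ a, σ a = 1 ∨ σ a = -1) (hxo : x o = 1) (hσo : σ o = 1) (hN : 4 * n + 2 * d ≤ N)
    (b : ι) (r W : ℝ) (hr0 : 0 ≤ r) (hr : ∀ a, a ≠ o → x a ≤ r)
    (hW : ∑ a ∈ Finset.univ.erase o, ∑ b, ω a b ≤ W) :
    ω o b * (x b ^ (2 * n) - x b ^ (4 * n)) ≤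
      (sandwich ω x σ N d n - sandwich ω x σ N d (2 * n)) + 2 * W * r ^ (N - 4 * n - 2 * d) := by
  have hmain := twoShift_signal_le ω x σ o N d n hω hx0 hx1 hσ hxo hσo hN
  -- the single term is below the (termwise nonnegative) top-row sum
  have hterm : ∀ c, 0 ≤ ω o c * (x c ^ (2 * n) - x c ^ (4 * n)) := fun c =>
    mul_nonneg (hω o c) (sub_nonneg.2 (pow_le_pow_of_le_one (hx0 c) (hx1 c) (by omega)))
  have hsingle : ω o b * (x b ^ (2 * n) - x b ^ (4 * n)) ≤ ∑ c, ω o c * (x c ^ (2 * n) - x c ^ (4 * n)) :=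
    Finset.single_le_sum (fun c _ => hterm c) (Finset.mem_univ b)
  -- the junk is monotone in the moduli
  have hjunk : ∑ a ∈ Finset.univ.erase o, ∑ c, ω a c * x a ^ (N - 4 * n - 2 * d) ≤ W * r ^ (N - 4 * n - 2 * d) := by
    calc ∑ a ∈ Finset.univ.erase o, ∑ c, ω a c * x a ^ (N - 4 * n - 2 * d)
        ≤ ∑ a ∈ Finset.univ.erase o, ∑ c, ω a c * r ^ (N - 4 * n - 2 * d) := by
          refine Finset.sum_le_sum fun a ha => Finset.sum_le_sum fun c _ => ?_
          exact mul_le_mul_of_nonneg_left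
            (pow_le_pow_left₀ (hx0 a) (hr a (Finset.ne_of_mem_erase ha)) _) (hω a c)
      _ = (∑ a ∈ Finset.univ.erase o, ∑ c, ω a c) * r ^ (N - 4 * n - 2 * d) := by
          rw [Finset.sum_mul]; refine Finset.sum_congr rfl fun a _ => ?_; rw [Finset.sum_mul]
      _ ≤ W * r ^ (N - 4 * n - 2 * d) := mul_le_mul_of_nonneg_right hW (pow_nonneg hr0 _)
  linarith

/-- **Extraction step (fixed `k`, pure arithmetic).**  Signal for the slowest mode with visible weight `v > 0`, junk `≤ v/8` per unit
`r^{2n}`, `r^{2n} ≤ 1/2` (torus-scale gap), two-shift budget `B ≤ (3/8) v q^{2n}` ⇒ `r ≤ q`. -/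
theorem extraction_step {v r B J q : ℝ} {n : ℕ} (hv : 0 < v) (hr0 : 0 ≤ r) (hq : 0 ≤ q) (hn : n ≠ 0)
    (hsig : v * (r ^ (2 * n) - r ^ (4 * n)) ≤ B + J * r ^ (2 * n))
    (hJ : J ≤ v / 8) (hhalf : r ^ (2 * n) ≤ 1 / 2) (hB : B ≤ 3 / 8 * v * q ^ (2 * n)) : r ≤ q := by
  have hs0 : 0 ≤ r ^ (2 * n) := pow_nonneg hr0 _
  have hsq : r ^ (4 * n) = (r ^ (2 * n)) ^ 2 := by rw [← pow_mul]; ring_nf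
  rw [hsq] at hsig
  set s := r ^ (2 * n) with hs
  have h1 : s ^ 2 ≤ s / 2 := by nlinarith
  have h2 : J * s ≤ v / 8 * s := mul_le_mul_of_nonneg_right hJ hs0
  have h3 : 3 / 8 * v * s ≤ B := by nlinarith
  have h4 : s ≤ q ^ (2 * n) := by
    have := h3.trans hB
    have hv' : 0 < 3 / 8 * v := by positivity
    nlinarith
  exact (pow_le_pow_iff_left₀ hr0 hq (by omega : 2 * n ≠ 0)).1 h4

/-- **Instantiation recipe for the `signal` field of `TwoShiftProbes` (PROVED).**  With a two-sided clustering bound at the shifts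
`n, 2n` around a common centre `μ` (the squared mean) and the spare-leg bookkeeping `N − 4n − 2d = p + 2n`, the slowest mode `b`
(`x_b = r`) obeys exactly the field's inequality `ω(o,b)(r^{2n} − r^{4n}) ≤ (ε₁ + ε₂) + 2 W r^{p} r^{2n}`. -/
theorem signal_shape (ω : ι → ι → ℝ) (x σ : ι → ℝ) (o : ι) (N d n p : ℕ)
    (hω : ∀ a b, 0 ≤ ω a b) (hx0 : ∀ a, 0 ≤ x a) (hx1 : ∀ a, x a ≤ 1)
    (hσ : ∀ a, σ a = 1 ∨ σ a = -1) (hxo : x o = 1) (hσo : σ o = 1) (hNp : N - 4 * n - 2 * d = p + 2 * n)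
    (hN : 4 * n + 2 * d ≤ N) (b : ι) (W μ ε₁ ε₂ : ℝ) (hr : ∀ a, a ≠ o → x a ≤ x b)
    (hW : ∑ a ∈ Finset.univ.erase o, ∑ b, ω a b ≤ W)
    (h₁ : |sandwich ω x σ N d n - μ| ≤ ε₁) (h₂ : |sandwich ω x σ N d (2 * n) - μ| ≤ ε₂) :
    ω o b * (x b ^ (2 * n) - x b ^ (4 * n)) ≤ (ε₁ + ε₂) + 2 * W * x b ^ p * x b ^ (2 * n) := by
  have h := slowest_signal_le ω x σ o N d n hω hx0 hx1 hσ hxo hσo hN b (x b) W (hx0 b) hr hW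
  rw [hNp, pow_add] at h
  have hd : sandwich ω x σ N d n - sandwich ω x σ N d (2 * n) ≤ ε₁ + ε₂ := by
    have := abs_le.1 h₁; have := abs_le.1 h₂; linarith
  linarith

end FiniteDim

/-! ## §2 The model-level letters and the bridge to R1 (PROVED) -/

section Model

variable {G : Type} [Group G] [TopologicalSpace G] [IsTopologicalGroup G] [CompactSpace G]
  [MeasurableSpace G] [BorelSpace G] {r : LatticeRep G} {sch : SpeciesScheme (YMSpecies G)}

/-- **Enriched model binder: two-shift probe data on a `DiagonalSliceModel`.**  Per step `k`: the slowest non-top modulus ratio `r k`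
(dominating every `U`-odd modulus and every `U`-even one except the distinguished top index `j₀ k`), the shift `n k` (a fixed fraction of
the side, inside `DiagCluster`'s admissible range `n ≤ S/2 − 2T − 3`), the spare leg `p k = N − 6 n − 2d ≥ 3 side/8`, and for ONE witness
probe `Y_k` (box-local, aimed at a mode attaining `r k`): its visible weight `vis k = ω(o,b_k)` (normalised by `Tr K₁^N / λ₀^{N−2d}`), the
total off-top weight `W k = Σ_{a ≠ o} w(a)`, its scale `scale k = Var Y_k + C ‖Y_k‖_∞²`, the two-shift budget
`budget k ≥ |S(n) − S(2n)|` (normalised), and the SIGNAL inequality — §1 `slowest_signal_le` instantiated (`r^{N−4n−2d} = r^{p}·r^{2n}`).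
Supplying such a `𝔭` for Wilson's diagonal model = the SHIFTED SANDWICH (hand-3's P3 sandwich `exists_sandwichWeights` with the second
functional translated by `n d`; two-index weights `|X̃_{ab}|²`, row sums = the model's `wp/wm`) — bookkeeping of size S–M, not done here. -/
structure TwoShiftProbes (𝔪 : DiagonalSliceModel r sch) where
  /-- slowest non-top modulus ratio at step `k` -/
  r : ℕ → ℝ
  /-- distinguished `U`-even top index -/
  j₀ : ℕ → ℕ
  /-- the shift (in `d`-steps) and the spare leg -/
  n : ℕ → ℕ
  p : ℕ → ℕ
  /-- visible weight, off-top total weight, scale and two-shift budget of the witness probe -/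
  vis : ℕ → ℝ
  W : ℕ → ℝ
  scale : ℕ → ℝ
  budget : ℕ → ℝ
  r_nonneg : ∀ k, 0 ≤ r k
  r_le_one : ∀ k, r k ≤ 1
  r_spec_odd : ∀ᶠ k in atTop, ∀ j, 𝔪.sm k j ≤ r k * 𝔪.top k
  r_spec_even : ∀ᶠ k in atTop, ∀ j, j ≠ j₀ k → 𝔪.sp k j ≤ r k * 𝔪.top k
  n_pos : ∀ k, n k ≠ 0
  n_ge : ∀ᶠ k in atTop, (sch.side k : ℝ) ≤ 16 * n k
  p_ge : ∀ᶠ k in atTop, 3 * (sch.side k : ℝ) ≤ 8 * p k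
  vis_pos : ∀ k, 0 < vis k
  W_nonneg : ∀ k, 0 ≤ W k
  scale_nonneg : ∀ k, 0 ≤ scale k
  /-- §1 `slowest_signal_le` for the witness probe: `vis (r^{2n} − r^{4n}) ≤ budget + 2 W r^{p} r^{2n}` -/
  signal : ∀ᶠ k in atTop,
    vis k * (r k ^ (2 * n k) - r k ^ (4 * n k)) ≤ budget k + 2 * W k * r k ^ p k * r k ^ (2 * n k)

variable {𝔪 : DiagonalSliceModel r sch}

/-- **LETTER `CoarseGap 𝔭 M`** (torus-scale gap, ALL sectors): no excitation of the diagonal transfer operator within `M_k/side_k` of the top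
in lattice log-units — `r_k ≤ exp(−M_k/side_k)`.  Weaker in RATE than any physical-scale gap (`M_k/side_k = (M_k/ℓ_k)·a_k` with `M_k/ℓ_k → 0`
allowed); fails for a massless theory (`r ≈ e^{−2π/side}`) iff `M_k → ∞`. -/
def CoarseGap (𝔭 : TwoShiftProbes 𝔪) (M : ℕ → ℝ) : Prop :=
  ∀ᶠ k in atTop, 𝔭.r k ≤ Real.exp (-(M k / sch.side k))

/-- **LETTER `JunkVisible 𝔭 M`**: the torus-scale gap beats the logarithm of (off-top weight / visible weight): `16 W_k ≤ vis_k · e^{3 M_k/8}`. -/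
def JunkVisible (𝔭 : TwoShiftProbes 𝔪) (M : ℕ → ℝ) : Prop :=
  ∀ᶠ k in atTop, 16 * 𝔭.W k ≤ 𝔭.vis k * Real.exp (3 * M k / 8)

/-- **LETTER `SlowestVisible 𝔭 η`** (sub-exponential visibility of the slowest mode, the typed `SlowModeVisible` of card #115): the probe's
scale is at most `e^{η a_k side_k}` times its visible weight on the slowest mode. -/
def SlowestVisible (𝔭 : TwoShiftProbes 𝔪) (η : ℝ) : Prop :=
  ∀ᶠ k in atTop, 𝔭.scale k ≤ 𝔭.vis k * Real.exp (η * (sch.a k * sch.side k))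

/-- **`BudgetDecay 𝔭 Δ`** (= `DiagCluster r sch Δ C` of card #115 at the two shifts `n_k, 2n_k`, thermal floor absorbed by `n ≤ S`):
`budget_k ≤ 2 e^{−Δ a_k n_k} · scale_k`. -/
def BudgetDecay (𝔭 : TwoShiftProbes 𝔪) (Δ : ℝ) : Prop :=
  ∀ᶠ k in atTop, 𝔭.budget k ≤ 2 * Real.exp (-(Δ * sch.a k * 𝔭.n k)) * 𝔭.scale k

/-- **THE BRIDGE (PROVED).**  Torus-scale gap + junk/visibility comparison + sub-exponential visibility (at `η = Δ/32`) + two-shift clustering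
budget ⇒ the slowest non-top modulus is `≤ exp(−(Δ/8) a_k)` eventually; in particular R1 `OddTwistGap 𝔪` (and the `U`-even two-step gap). -/
theorem slowest_le_exp (𝔭 : TwoShiftProbes 𝔪) {M : ℕ → ℝ} {Δ : ℝ} (hΔ : 0 < Δ) (hM : Tendsto M atTop atTop)
    (hgap : CoarseGap 𝔭 M) (hjunk : JunkVisible 𝔭 M) (hvis : SlowestVisible 𝔭 (Δ / 32)) (hbud : BudgetDecay 𝔭 Δ) :
    ∀ᶠ k in atTop, 𝔭.r k ≤ Real.exp (-(Δ / 8 * sch.a k)) := by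
  -- scheme asymptotics: `a_k n_k → ∞`
  have han : Tendsto (fun k => sch.a k * (𝔭.n k : ℝ)) atTop atTop := by
    have hx : Tendsto (fun k => sch.a k * (sch.side k : ℝ) / 16) atTop atTop :=
      (tendsto_a_mul_side' sch).atTop_div_const (by norm_num)
    refine tendsto_atTop_mono' atTop ?_ hx
    filter_upwards [𝔭.n_ge] with k hk
    have ha := (sch.a_pos k).le
    calc sch.a k * (sch.side k : ℝ) / 16 = sch.a k * ((sch.side k : ℝ) / 16) := by ring
      _ ≤ sch.a k * (𝔭.n k : ℝ) := mul_le_mul_of_nonneg_left (by linarith) ha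
  have hM8 : ∀ᶠ k in atTop, 8 * Real.log 2 ≤ M k := hM.eventually_ge_atTop _
  have hlog : ∀ᶠ k in atTop, Real.log (16 / 3) ≤ Δ / 4 * (sch.a k * 𝔭.n k) :=
    (han.const_mul_atTop (by positivity : 0 < Δ / 4)).eventually_ge_atTop _
  filter_upwards [hgap, hjunk, hvis, hbud, 𝔭.signal, 𝔭.n_ge, 𝔭.p_ge, hM8, hlog] with k hgap hjunk hvis hbud hsig hn hp hM8 hlog
  have hr0 := 𝔭.r_nonneg k
  have hv := 𝔭.vis_pos k
  have hW := 𝔭.W_nonneg k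
  have ha := sch.a_pos k
  have hnpos : (0 : ℝ) < 𝔭.n k := by exact_mod_cast Nat.pos_of_ne_zero (𝔭.n_pos k)
  have hside0 : (0 : ℝ) < sch.side k := by
    have : 0 < sch.side k := by simp [SpeciesScheme.side]
    exact_mod_cast this
  have hMpos : 0 < M k := by have := Real.log_pos (by norm_num : (1 : ℝ) < 2); linarith
  -- (E2) `r^{2n} ≤ 1/2`
  have hhalf : 𝔭.r k ^ (2 * 𝔭.n k) ≤ 1 / 2 := by
    have h1 : 𝔭.r k ^ (2 * 𝔭.n k) ≤ Real.exp (-(M k / sch.side k)) ^ (2 * 𝔭.n k) := pow_le_pow_left₀ hr0 hgap _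
    rw [← Real.exp_nat_mul] at h1
    refine h1.trans ?_
    have : ((2 * 𝔭.n k : ℕ) : ℝ) * -(M k / sch.side k) ≤ Real.log (1 / 2) := by
      rw [Real.log_div (by norm_num) (by norm_num), Real.log_one, zero_sub]
      have h2n : (sch.side k : ℝ) / 8 ≤ (2 * 𝔭.n k : ℕ) := by push_cast; linarith
      have : M k / 8 ≤ ((2 * 𝔭.n k : ℕ) : ℝ) * (M k / sch.side k) := by
        calc M k / 8 = (sch.side k : ℝ) / 8 * (M k / sch.side k) := by field_simp
          _ ≤ ((2 * 𝔭.n k : ℕ) : ℝ) * (M k / sch.side k) :=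
            mul_le_mul_of_nonneg_right h2n (div_nonneg hMpos.le hside0.le)
      nlinarith
    calc Real.exp (((2 * 𝔭.n k : ℕ) : ℝ) * -(M k / sch.side k)) ≤ Real.exp (Real.log (1 / 2)) := Real.exp_le_exp.2 this
      _ = 1 / 2 := Real.exp_log (by norm_num)
  -- (E3) junk `2 W r^p ≤ vis/8`
  have hJ : 2 * 𝔭.W k * 𝔭.r k ^ 𝔭.p k ≤ 𝔭.vis k / 8 := by
    have h1 : 𝔭.r k ^ 𝔭.p k ≤ Real.exp (-(M k / sch.side k)) ^ 𝔭.p k := pow_le_pow_left₀ hr0 hgap _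
    rw [← Real.exp_nat_mul] at h1
    have h2 : Real.exp ((𝔭.p k : ℝ) * -(M k / sch.side k)) ≤ Real.exp (-(3 * M k / 8)) := by
      refine Real.exp_le_exp.2 ?_
      have : 3 * M k / 8 ≤ (𝔭.p k : ℝ) * (M k / sch.side k) := by
        calc 3 * M k / 8 = 3 * (sch.side k : ℝ) / 8 * (M k / sch.side k) := by field_simp
          _ ≤ (𝔭.p k : ℝ) * (M k / sch.side k) :=
            mul_le_mul_of_nonneg_right (by linarith) (div_nonneg hMpos.le hside0.le)
      linarith
    have h3 : 𝔭.r k ^ 𝔭.p k ≤ Real.exp (-(3 * M k / 8)) := h1.trans h2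
    have h4 : 2 * 𝔭.W k * 𝔭.r k ^ 𝔭.p k ≤ 2 * 𝔭.W k * Real.exp (-(3 * M k / 8)) :=
      mul_le_mul_of_nonneg_left h3 (by positivity)
    refine h4.trans ?_
    -- `16 W ≤ vis e^{3M/8}` ⇒ `2 W e^{−3M/8} ≤ vis/8`
    have hE : Real.exp (-(3 * M k / 8)) * Real.exp (3 * M k / 8) = 1 := by
      rw [← Real.exp_add]; simp
    have hEpos : 0 < Real.exp (-(3 * M k / 8)) := Real.exp_pos _
    nlinarith [mul_le_mul_of_nonneg_right hjunk hEpos.le]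
  -- (E4) budget `≤ (3/8) vis q^{2n}` with `q = exp(−(Δ/8) a)`
  have hB : 𝔭.budget k ≤ 3 / 8 * 𝔭.vis k * Real.exp (-(Δ / 8 * sch.a k)) ^ (2 * 𝔭.n k) := by
    rw [← Real.exp_nat_mul]
    have h1 : 𝔭.budget k ≤ 2 * Real.exp (-(Δ * sch.a k * 𝔭.n k)) * (𝔭.vis k * Real.exp (Δ / 32 * (sch.a k * sch.side k))) :=
      hbud.trans (mul_le_mul_of_nonneg_left hvis (by positivity))
    refine h1.trans ?_
    -- exponent bookkeeping: `−Δ a n + (Δ/32) a side ≤ −(Δ/2) a n` (side ≤ 16 n) and `2 e^{−(Δ/2) a n} ≤ (3/8) e^{−(Δ/4) a n}`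
    have hexp1 : Real.exp (-(Δ * sch.a k * 𝔭.n k)) * Real.exp (Δ / 32 * (sch.a k * sch.side k)) ≤
        Real.exp (-(Δ / 2 * (sch.a k * 𝔭.n k))) := by
      rw [← Real.exp_add]; refine Real.exp_le_exp.2 ?_
      have : sch.a k * sch.side k ≤ 16 * (sch.a k * 𝔭.n k) := by nlinarith
      nlinarith
    have hexp2 : 2 * Real.exp (-(Δ / 2 * (sch.a k * 𝔭.n k))) ≤
        3 / 8 * Real.exp (((2 * 𝔭.n k : ℕ) : ℝ) * -(Δ / 8 * sch.a k)) := by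
      have hq : ((2 * 𝔭.n k : ℕ) : ℝ) * -(Δ / 8 * sch.a k) = -(Δ / 4 * (sch.a k * 𝔭.n k)) := by push_cast; ring
      rw [hq]
      -- `e^{−(Δ/4) a n} ≤ 3/16`
      have h16 : Real.exp (-(Δ / 4 * (sch.a k * 𝔭.n k))) ≤ 3 / 16 := by
        have : -(Δ / 4 * (sch.a k * 𝔭.n k)) ≤ Real.log (3 / 16) := by
          have hl : Real.log (3 / 16) = -Real.log (16 / 3) := by
            rw [← Real.log_inv]; norm_num
          linarith
        calc Real.exp (-(Δ / 4 * (sch.a k * 𝔭.n k))) ≤ Real.exp (Real.log (3 / 16)) := Real.exp_le_exp.2 this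
          _ = 3 / 16 := Real.exp_log (by norm_num)
      have hsqr : Real.exp (-(Δ / 2 * (sch.a k * 𝔭.n k))) =
          Real.exp (-(Δ / 4 * (sch.a k * 𝔭.n k))) * Real.exp (-(Δ / 4 * (sch.a k * 𝔭.n k))) := by
        rw [← Real.exp_add]; ring_nf
      rw [hsqr]
      nlinarith [Real.exp_pos (-(Δ / 4 * (sch.a k * 𝔭.n k)))]
    calc 2 * Real.exp (-(Δ * sch.a k * 𝔭.n k)) * (𝔭.vis k * Real.exp (Δ / 32 * (sch.a k * sch.side k)))
        = 𝔭.vis k * (2 * (Real.exp (-(Δ * sch.a k * 𝔭.n k)) * Real.exp (Δ / 32 * (sch.a k * sch.side k)))) := by ring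
      _ ≤ 𝔭.vis k * (2 * Real.exp (-(Δ / 2 * (sch.a k * 𝔭.n k)))) :=
          mul_le_mul_of_nonneg_left (by linarith) hv.le
      _ ≤ 𝔭.vis k * (3 / 8 * Real.exp (((2 * 𝔭.n k : ℕ) : ℝ) * -(Δ / 8 * sch.a k))) :=
          mul_le_mul_of_nonneg_left hexp2 hv.le
      _ = 3 / 8 * 𝔭.vis k * Real.exp (((2 * 𝔭.n k : ℕ) : ℝ) * -(Δ / 8 * sch.a k)) := by ring
  -- the signal in the shape of `extraction_step`
  have hsig' : 𝔭.vis k * (𝔭.r k ^ (2 * 𝔭.n k) - 𝔭.r k ^ (4 * 𝔭.n k)) ≤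
      𝔭.budget k + (2 * 𝔭.W k * 𝔭.r k ^ 𝔭.p k) * 𝔭.r k ^ (2 * 𝔭.n k) := by
    simpa [mul_assoc] using hsig
  exact extraction_step hv hr0 (Real.exp_pos _).le (𝔭.n_pos k) hsig' hJ hhalf hB

/-- **R1 from the two-shift letters (PROVED composition).** -/
theorem oddTwistGap_of_twoShiftLetters (𝔭 : TwoShiftProbes 𝔪) {M : ℕ → ℝ} {Δ : ℝ} (hΔ : 0 < Δ)
    (hM : Tendsto M atTop atTop) (hgap : CoarseGap 𝔭 M) (hjunk : JunkVisible 𝔭 M)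
    (hvis : SlowestVisible 𝔭 (Δ / 32)) (hbud : BudgetDecay 𝔭 Δ) : OddTwistGap 𝔪 := by
  refine ⟨Δ / 8, by positivity, ?_⟩
  filter_upwards [slowest_le_exp 𝔭 hΔ hM hgap hjunk hvis hbud, 𝔭.r_spec_odd] with k hk hodd j
  exact (hodd j).trans (mul_le_mul_of_nonneg_right hk (𝔪.top_pos k).le)

/-- The `U`-even two-step gap comes with it (all non-top even moduli `≤ e^{−(Δ/8) a_k} λ₀`). -/
theorem evenGap_of_twoShiftLetters (𝔭 : TwoShiftProbes 𝔪) {M : ℕ → ℝ} {Δ : ℝ} (hΔ : 0 < Δ)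
    (hM : Tendsto M atTop atTop) (hgap : CoarseGap 𝔭 M) (hjunk : JunkVisible 𝔭 M)
    (hvis : SlowestVisible 𝔭 (Δ / 32)) (hbud : BudgetDecay 𝔭 Δ) :
    ∀ᶠ k in atTop, ∀ j, j ≠ 𝔭.j₀ k → 𝔪.sp k j ≤ Real.exp (-(Δ / 8 * sch.a k)) * 𝔪.top k := by
  filter_upwards [slowest_le_exp 𝔭 hΔ hM hgap hjunk hvis hbud, 𝔭.r_spec_even] with k hk heven j hj
  exact (heven j hj).trans (mul_le_mul_of_nonneg_right hk (𝔪.top_pos k).le)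

end Model

end Summit.QuantumFields.YangMills.Cruxes.DiagonalMirrorRPR.SignTwistedDiagonalTrace

end
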